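import Literature.AnabelianGeometry.AbsoluteAnabelian.UnitKummerModel
import HarnessLib

/-!
# [AbsTopIII] Prop 3.3 (i) / 3.2 (ii): NATURALITY of the (unit) Kummer maps along GENERAL (non-invertible)
# morphisms of MLF-Galois pairs — the functoriality clause «relative to `C^MLF_T`, in the evident sense»

S. Mochizuki, *Topics in absolute anabelian geometry III*, §3, Prop. 3.3 (i) p. 73 (bib key
`MochizukiAbsTopIII2015`; locators = kurims manuscript pages, lit key `paper:url-5493eb38cbb7`):
"By considering the action of open subgroups `H ⊆ Π` on elements of `M` that are roots of elements of
`M^H`, we obtain a functorial [i.e., relative to `C^MLF_T`, in the evident sense] algorithm for constructing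
the Kummer maps `M^H → H¹(H, μ_Ẑ(M))`"; Def. 3.1 (ii) p. 67 makes the morphisms of `C^MLF_T` GENERAL:
"a morphism of objects `φ_M : M₁ → M₂` of `T`, together with a compatible continuous homomorphism
`φ_Π : Π₁ → Π₂` …" [cite: MochizukiAbsTopIII2015, Proposition 3.3 (i) p.73].

abc-iut cell, layer L4, row «Prop33i-NATURALITY» (abc-iut-L4-lead RULING #5g (5); seat abc-iut-w4-d009
gen 4; read of record abc-iut-w4-d104: node AbsTopIII:Prop3.3(i) was «object level + Iso-transport»
(`UnitKummerTransport.lean`, p422559); the clause typed/proved HERE is functoriality for NON-INVERTIBLE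
morphisms).  PROOF-ONLY companion (0 `def`s) of `UnitKummerModel.lean` (abc-iut-L4-t2) and of the Kummer
functoriality API `EtaleTheta/KummerFunctoriality.lean` (abc-iut-L2-t3, LANA §6.1: `CoMorphism`,
`CoMorphism.H1Map` = Mathlib `groupCohomology.map` in degree `1` along ANY group homomorphism,
`CoMorphism.map_kummerClass`).  Everything BY NAME; nothing restated.

SHAPE.  `H¹(H, Λ(A))` is contravariant in the group and covariant in the module, so a morphism of pairs in
the SAME direction, `(φ_Π, φ_M) : (Π₁ ↷ M₁) → (Π₂ ↷ M₂)` with `φ_M(g·m) = φ_Π(g)·φ_M(m)`, acts on Kummer classes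
by the ZIGZAG through the restricted pair `(Π₁ ↷ M₂|_{φ_Π})`:
`H¹(H₂, Λ(M₂)) —pull (φ_Π, id)→ H¹(H₁, Λ(M₂)|_{φ_Π}) ←push (id, Λ(φ_M))— H¹(H₁, Λ(M₁))` for `φ_Π(H₁) ≤ H₂`,
and NATURALITY says: for `m₁ ∈ M₁^{H₁}`, `m₂ ∈ M₂^{H₂}` with `φ_M(m₁) = m₂`,
`pull (κ₂ m₂) = push (κ₁ m₁)` — both being the Kummer class of `m₂` in the restricted pair.

* §1 `CoMorphism.H1Map_kummerClass_eq_of_map_eq` — abstract zigzag: two co-morphisms into a common pair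
  agreeing on an invariant element have `H¹`-maps agreeing on its Kummer classes.
* §2 `EtaleTheta.kummerClass_natural` — the same-direction form for `(f : G₁ →* G₂, φ : A₁ →* A₂)` with
  `φ (g • a) = f g • φ a`, the restricted action of `G₁` on `A₂` being any compatible action
  (`hres : g • a = f g • a`; e.g. `MulDistribMulAction.compHom A₂ f`).
* §3 MODEL `TLG`: for ANY morphism `φ : GaloisMonoidPair.Hom D₁.tlgPair D₂.tlgPair` of the model
  `TLG`-pairs of Def. 3.1 (i) over two MLF closures (unit map = `φ.homM` read on `k̄ˣ ≃ (k̄)⁰`):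
  `ModelMLFGaloisData.unitKummerTheoryTLG_kummer_natural` (any compatible restricted action) and
  `…_natural_of_aug` (same `k̄`, `φ_Π` over `G_k`: no auxiliary datum at all).
* §4 MODEL `TCG`: `unitKummerTheoryTCG_kummer_natural(_of_aug)` for morphisms `φ` of the model `TCG`-pairs
  whose unit map `φ_M : 𝒪_{k̄₁}^× → 𝒪_{k̄₂}^×` is given together with a compatible equivariant map `Φ` on `k̄ˣ`
  (the coefficient map `Λ(φ_M)` only sees torsion, which lies in `𝒪^×`; t2's model `TCG` Kummer classes
  live in `H¹(H, Λ(k̄ˣ))`, whence the bookkeeping datum `Φ` — automatic for morphisms «over `k̄`»).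

HONEST FRAMING: OUR kernel statements about the model objects of a refereed 2015 paper; nothing here bears
on [IUTchIII] Cor. 3.12; typed ≠ proved elsewhere.
-/

noncomputable section

open scoped nonZeroDivisors

/-! ## §1–§2 Abstract naturality of Kummer classes (over `EtaleTheta.CoMorphism`) -/

namespace Literature.AnabelianGeometry.EtaleTheta

open groupCohomology

namespace CoMorphism

variable {GX AX GX' AX' GY AY : Type} [Group GX] [CommGroup AX] [MulDistribMulAction GX AX]
  [Group GX'] [CommGroup AX'] [MulDistribMulAction GX' AX'] [Group GY] [CommGroup AY]
  [MulDistribMulAction GY AY] [RootableBy AX ℕ] [RootableBy AX' ℕ] [RootableBy AY ℕ]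

/-- **Zigzag naturality of Kummer classes.**  Two equivariant co-morphisms `c : (G_Y, A_Y) → (G_X, A_X)`,
`d : (G_Y, A_Y) → (G_X', A_X')` into a common pair, subgroups `H ≤ G_X`, `H' ≤ G_X'`, `K ≤ G_Y` with
`c_*(K) ≤ H`, `d_*(K) ≤ H'`, and invariant elements `a ∈ A_X^H`, `a' ∈ A_X'^{H'}` with the same image
`c^*(a) = d^*(a')` in `A_Y`: the induced maps on `H¹` carry `κ_H(a)` and `κ_{H'}(a')` to the same class in
`H¹(K, Λ(A_Y))` (namely `κ_K(c^* a)`; LANA §6.1 square `CoMorphism.map_kummerClass` twice).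
[cite: MochizukiAbsTopIII2015, Proposition 3.3 (i) p.73] -/
theorem H1Map_kummerClass_eq_of_map_eq (c : CoMorphism GX AX GY AY) (d : CoMorphism GX' AX' GY AY)
    {H : Subgroup GX} {H' : Subgroup GX'} {K : Subgroup GY} (hc : K.map c.groupHom ≤ H)
    (hd : K.map d.groupHom ≤ H') (a : invariants (A := AX) H) (a' : invariants (A := AX') H')
    (h : c.map a = d.map a') :
    c.H1Map hc (kummerClass H a) = d.H1Map hd (kummerClass H' a') := by
  rw [c.map_kummerClass hc a, d.map_kummerClass hd a']
  congr 1
  exact Subtype.ext h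

end CoMorphism

section Natural

variable {G₁ A₁ G₂ A₂ : Type} [Group G₁] [CommGroup A₁] [MulDistribMulAction G₁ A₁]
  [Group G₂] [CommGroup A₂] [MulDistribMulAction G₂ A₂] [MulDistribMulAction G₁ A₂]
  [RootableBy A₁ ℕ] [RootableBy A₂ ℕ]

/-- **Naturality of Kummer classes along a same-direction morphism of pairs** `(f, φ) : (G₁ ↷ A₁) → (G₂ ↷ A₂)`
(`φ (g • a) = f g • φ a`), the auxiliary action of `G₁` on `A₂` being any action compatible with `f`
(`hres`): for `H₁ ≤ G₁`, `H₂ ≤ G₂` with `f(H₁) ≤ H₂` and `a₁ ∈ A₁^{H₁}`, `a₂ ∈ A₂^{H₂}` with `φ a₁ = a₂`,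
the pull-back of `κ_{H₂}(a₂)` along `(f, id)` equals the push-forward of `κ_{H₁}(a₁)` along `(id, Λ(φ))` in
`H¹(H₁, Λ(A₂))`. [cite: MochizukiAbsTopIII2015, Proposition 3.3 (i) p.73] -/
theorem kummerClass_natural (f : G₁ →* G₂) (φ : A₁ →* A₂) (hφ : ∀ (g : G₁) (a : A₁), φ (g • a) = f g • φ a)
    (hres : ∀ (g : G₁) (a : A₂), g • a = f g • a) {H₁ : Subgroup G₁} {H₂ : Subgroup G₂}
    (hH : H₁.map f ≤ H₂) (a₁ : invariants (A := A₁) H₁) (a₂ : invariants (A := A₂) H₂)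
    (h : φ a₁ = a₂) :
    (⟨f, MonoidHom.id A₂, fun g a => (hres g a).symm⟩ : CoMorphism G₂ A₂ G₁ A₂).H1Map hH
        (kummerClass H₂ a₂) =
      (⟨MonoidHom.id G₁, φ, fun g a => (hφ g a).trans (hres g (φ a)).symm⟩ :
          CoMorphism G₁ A₁ G₁ A₂).H1Map (Subgroup.map_id _).le (kummerClass H₁ a₁) :=
  CoMorphism.H1Map_kummerClass_eq_of_map_eq _ _ hH _ a₂ a₁ h.symm

/-- The canonical choice `H₁ := f⁻¹(H₂)` in `kummerClass_natural`.
[cite: MochizukiAbsTopIII2015, Proposition 3.3 (i) p.73] -/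
theorem kummerClass_natural_comap (f : G₁ →* G₂) (φ : A₁ →* A₂)
    (hφ : ∀ (g : G₁) (a : A₁), φ (g • a) = f g • φ a) (hres : ∀ (g : G₁) (a : A₂), g • a = f g • a)
    (H₂ : Subgroup G₂) (a₁ : invariants (A := A₁) (H₂.comap f)) (a₂ : invariants (A := A₂) H₂)
    (h : φ a₁ = a₂) :
    (⟨f, MonoidHom.id A₂, fun g a => (hres g a).symm⟩ : CoMorphism G₂ A₂ G₁ A₂).H1Map
        (Subgroup.map_comap_le f H₂) (kummerClass H₂ a₂) =
      (⟨MonoidHom.id G₁, φ, fun g a => (hφ g a).trans (hres g (φ a)).symm⟩ :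
          CoMorphism G₁ A₁ G₁ A₂).H1Map (Subgroup.map_id _).le (kummerClass (H₂.comap f) a₁) :=
  kummerClass_natural f φ hφ hres (Subgroup.map_comap_le f H₂) a₁ a₂ h

end Natural

end Literature.AnabelianGeometry.EtaleTheta

/-! ## §3–§4 The MODEL unit Kummer theories of [AbsTopIII] Prop 3.3 (i) -/

namespace Literature.AnabelianGeometry.AbsoluteAnabelian

open Literature.AnabelianGeometry.EtaleTheta (CoMorphism kummerClass invariants)

namespace ModelMLFGaloisData

variable (C₁ C₂ : MLFClosure.{0}) (D₁ : ModelMLFGaloisData C₁.k C₁.K) (D₂ : ModelMLFGaloisData C₂.k C₂.K)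

/-! ### §3 `TLG`: `(Π_k ↷ k̄^×)` -/

/-- The unit of `k̄` underlying `m ∈ k̄^×` is Mathlib's `nonZeroDivisorsEquivUnits m` (t2's `tlgToUnit`).
[cite: MochizukiAbsTopIII2015, Definition 3.1 (i) p.67] -/
theorem tlgToUnit_eq_nonZeroDivisorsEquivUnits (m : (C₁.K)⁰) :
    tlgToUnit C₁ m = nonZeroDivisorsEquivUnits m :=
  Units.ext rfl

/-- The unit map `φ_M : k̄₁^× → k̄₂^×` of a morphism of the model `TLG`-pairs, read on `k̄ˣ`, is compatible
with `φ_Π` for the Galois actions: `φ_M(g • u) = φ_Π(g) • φ_M(u)` (Def. 3.1 (ii) "compatible").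
[cite: MochizukiAbsTopIII2015, Definition 3.1 (ii) p.67] -/
theorem tlgHom_unitsMap_smul (φ : GaloisMonoidPair.Hom D₁.tlgPair D₂.tlgPair) (g : D₁.Pi) (u : (C₁.K)ˣ) :
    (nonZeroDivisorsEquivUnits.toMonoidHom.comp
        (φ.homM.comp (nonZeroDivisorsEquivUnits (G₀ := C₁.K)).symm.toMonoidHom)) (g • u) =
      φ.homPi g • (nonZeroDivisorsEquivUnits.toMonoidHom.comp
        (φ.homM.comp (nonZeroDivisorsEquivUnits (G₀ := C₁.K)).symm.toMonoidHom)) u := by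
  refine Units.ext ?_
  have hx : (nonZeroDivisorsEquivUnits (G₀ := C₁.K)).symm (g • u) =
      g • (nonZeroDivisorsEquivUnits (G₀ := C₁.K)).symm u := Subtype.ext rfl
  change (((φ.homM ((nonZeroDivisorsEquivUnits (G₀ := C₁.K)).symm (g • u)) : (C₂.K)⁰)) : C₂.K) =
    D₂.aug (φ.homPi g) • ((φ.homM ((nonZeroDivisorsEquivUnits (G₀ := C₁.K)).symm u) : (C₂.K)⁰) : C₂.K)
  rw [hx, φ.smul_comm]
  rfl

/-- **Prop 3.3 (i), functoriality of the unit Kummer maps for GENERAL morphisms — model `TLG`-pairs.**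
For a morphism `φ = (φ_Π, φ_M) : (Π_{k₁} ↷ k̄₁^×) → (Π_{k₂} ↷ k̄₂^×)` of the model `TLG`-pairs (Def. 3.1 (ii):
any compatible continuous `φ_Π`, not necessarily invertible), any action of `Π_{k₁}` on `k̄₂ˣ` compatible with
`φ_Π` (`hres`), open `H₁ ≤ Π_{k₁}`, `H₂ ≤ Π_{k₂}` with `φ_Π(H₁) ≤ H₂`, and `m₁ ∈ (k̄₁^×)^{H₁}`, `m₂ ∈ (k̄₂^×)^{H₂}`
with `φ_M(m₁) = m₂`: the pull-back along `(φ_Π, id)` of the Kummer class `κ_{H₂}(m₂)` of t2's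
`unitKummerTheoryTLG` equals the push-forward along `(id, Λ(φ_M))` of `κ_{H₁}(m₁)`, in `H¹(H₁, Λ(k̄₂ˣ))`.
[cite: MochizukiAbsTopIII2015, Proposition 3.3 (i) p.73] -/
theorem unitKummerTheoryTLG_kummer_natural [MulDistribMulAction D₁.Pi (C₂.K)ˣ]
    (φ : GaloisMonoidPair.Hom D₁.tlgPair D₂.tlgPair)
    (hres : ∀ (g : D₁.Pi) (u : (C₂.K)ˣ), g • u = φ.homPi g • u)
    {H₁ : OpenSubgroup D₁.tlgPair.Pi} {H₂ : OpenSubgroup D₂.tlgPair.Pi}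
    (hH : (H₁ : Subgroup D₁.Pi).map φ.homPi ≤ (H₂ : Subgroup D₂.Pi))
    (m₁ : {m : D₁.tlgPair.M // ∀ h : H₁, (h : D₁.tlgPair.Pi) • m = m})
    (m₂ : {m : D₂.tlgPair.M // ∀ h : H₂, (h : D₂.tlgPair.Pi) • m = m}) (h : φ.homM m₁.1 = m₂.1) :
    (⟨φ.homPi, MonoidHom.id (C₂.K)ˣ, fun g u => (hres g u).symm⟩ :
        CoMorphism D₂.Pi (C₂.K)ˣ D₁.Pi (C₂.K)ˣ).H1Map hH ((D₂.unitKummerTheoryTLG C₂).kummer H₂ m₂) =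
      (⟨MonoidHom.id D₁.Pi, nonZeroDivisorsEquivUnits.toMonoidHom.comp
          (φ.homM.comp (nonZeroDivisorsEquivUnits (G₀ := C₁.K)).symm.toMonoidHom),
          fun g u => (tlgHom_unitsMap_smul C₁ C₂ D₁ D₂ φ g u).trans (hres g _).symm⟩ :
        CoMorphism D₁.Pi (C₁.K)ˣ D₁.Pi (C₂.K)ˣ).H1Map (Subgroup.map_id _).le
        ((D₁.unitKummerTheoryTLG C₁).kummer H₁ m₁) := by
  rw [unitKummerTheoryTLG_kummer, unitKummerTheoryTLG_kummer]
  refine CoMorphism.H1Map_kummerClass_eq_of_map_eq _ _ hH _ _ _ ?_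
  change tlgToUnit C₂ m₂.1 =
    nonZeroDivisorsEquivUnits (φ.homM ((nonZeroDivisorsEquivUnits (G₀ := C₁.K)).symm (tlgToUnit C₁ m₁.1)))
  rw [tlgToUnit_eq_nonZeroDivisorsEquivUnits, tlgToUnit_eq_nonZeroDivisorsEquivUnits, MulEquiv.symm_apply_apply, h]

variable {C₁ C₂ D₁ D₂} in
/-- The canonical level for `unitKummerTheoryTLG_kummer_natural`: for open `H₂ ≤ Π_{k₂}` the open subgroup
`H₁ := φ_Π⁻¹(H₂) ≤ Π_{k₁}` (Mathlib `OpenSubgroup.comap`, `φ_Π` continuous) satisfies `φ_Π(H₁) ≤ H₂`.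
[cite: MochizukiAbsTopIII2015, Proposition 3.3 (i) p.73] -/
theorem map_comap_homPi_le (φ : GaloisMonoidPair.Hom D₁.tlgPair D₂.tlgPair) (H₂ : OpenSubgroup D₂.tlgPair.Pi) :
    ((H₂.comap φ.homPi φ.continuous_homPi : OpenSubgroup D₁.tlgPair.Pi) : Subgroup D₁.Pi).map φ.homPi ≤
      (H₂ : Subgroup D₂.Pi) := by
  rw [OpenSubgroup.toSubgroup_comap]
  exact Subgroup.map_comap_le _ _

/-- **Same `k̄`, `φ_Π` over `G_k`: no auxiliary datum.**  For two models `Π_k ↠ G_k`, `Π'_k ↠ G_k` over the SAME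
MLF closure and a morphism `φ` of their `TLG`-pairs with `ε' ∘ φ_Π = ε` (`haug`; e.g. the inclusion of an open
subgroup, or any `φ_Π` over the identity of `G_k` with `φ_M` Galois-equivariant), the restricted action is the
model action of `Π_k` itself and the naturality square holds outright.
[cite: MochizukiAbsTopIII2015, Proposition 3.3 (i) p.73] -/
theorem unitKummerTheoryTLG_kummer_natural_of_aug (C : MLFClosure.{0}) (D D' : ModelMLFGaloisData C.k C.K)
    (φ : GaloisMonoidPair.Hom D.tlgPair D'.tlgPair) (haug : ∀ g : D.Pi, D'.aug (φ.homPi g) = D.aug g)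
    {H₁ : OpenSubgroup D.tlgPair.Pi} {H₂ : OpenSubgroup D'.tlgPair.Pi}
    (hH : (H₁ : Subgroup D.Pi).map φ.homPi ≤ (H₂ : Subgroup D'.Pi))
    (m₁ : {m : D.tlgPair.M // ∀ h : H₁, (h : D.tlgPair.Pi) • m = m})
    (m₂ : {m : D'.tlgPair.M // ∀ h : H₂, (h : D'.tlgPair.Pi) • m = m}) (h : φ.homM m₁.1 = m₂.1) :
    (⟨φ.homPi, MonoidHom.id (C.K)ˣ, fun g u => Units.ext (by
          change D'.aug (φ.homPi g) • (u : C.K) = D.aug g • (u : C.K)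
          rw [haug])⟩ :
        CoMorphism D'.Pi (C.K)ˣ D.Pi (C.K)ˣ).H1Map hH ((D'.unitKummerTheoryTLG C).kummer H₂ m₂) =
      (⟨MonoidHom.id D.Pi, nonZeroDivisorsEquivUnits.toMonoidHom.comp
          (φ.homM.comp (nonZeroDivisorsEquivUnits (G₀ := C.K)).symm.toMonoidHom),
          fun g u => (tlgHom_unitsMap_smul C C D D' φ g u).trans (Units.ext (by
            rw [units_coe_smul, units_coe_smul, haug]))⟩ :
        CoMorphism D.Pi (C.K)ˣ D.Pi (C.K)ˣ).H1Map (Subgroup.map_id _).le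
        ((D.unitKummerTheoryTLG C).kummer H₁ m₁) :=
  unitKummerTheoryTLG_kummer_natural C C D D' φ
    (fun g u => Units.ext (by
      change D.aug g • (u : C.K) = D'.aug (φ.homPi g) • (u : C.K)
      rw [haug])) hH m₁ m₂ h

/-! ### §4 `TCG`: `(Π_k ↷ 𝒪_k̄^×)` -/

/-- **Prop 3.3 (i), functoriality of the unit Kummer maps for GENERAL morphisms — model `TCG`-pairs**, for a
morphism `φ = (φ_Π, φ_M) : (Π_{k₁} ↷ 𝒪_{k̄₁}^×) → (Π_{k₂} ↷ 𝒪_{k̄₂}^×)` whose unit map is given together with a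
`φ_Π`-equivariant map `Φ : k̄₁ˣ → k̄₂ˣ` extending it (t2's model `TCG` Kummer classes live in `H¹(H, Λ(k̄ˣ))`;
the coefficient map `Λ(φ_M)` only involves the torsion of `𝒪^×`, so `Φ` is bookkeeping): with `hres`, `hH`,
`m₁`, `m₂`, `h` as in the `TLG` case, pull-back of `κ_{H₂}(m₂)` = push-forward of `κ_{H₁}(m₁)`.
[cite: MochizukiAbsTopIII2015, Proposition 3.3 (i) p.73] -/
theorem unitKummerTheoryTCG_kummer_natural [MulDistribMulAction D₁.Pi (C₂.K)ˣ]
    (φ : GaloisMonoidPair.Hom D₁.tcgPair D₂.tcgPair)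
    (hres : ∀ (g : D₁.Pi) (u : (C₂.K)ˣ), g • u = φ.homPi g • u)
    (Φ : (C₁.K)ˣ →* (C₂.K)ˣ) (hΦ : ∀ m : unitSubmonoid C₁.k C₁.K, Φ (tcgToUnit C₁ m) = tcgToUnit C₂ (φ.homM m))
    (hΦs : ∀ (g : D₁.Pi) (u : (C₁.K)ˣ), Φ (g • u) = φ.homPi g • Φ u)
    {H₁ : OpenSubgroup D₁.tcgPair.Pi} {H₂ : OpenSubgroup D₂.tcgPair.Pi}
    (hH : (H₁ : Subgroup D₁.Pi).map φ.homPi ≤ (H₂ : Subgroup D₂.Pi))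
    (m₁ : {m : D₁.tcgPair.M // ∀ h : H₁, (h : D₁.tcgPair.Pi) • m = m})
    (m₂ : {m : D₂.tcgPair.M // ∀ h : H₂, (h : D₂.tcgPair.Pi) • m = m}) (h : φ.homM m₁.1 = m₂.1) :
    (⟨φ.homPi, MonoidHom.id (C₂.K)ˣ, fun g u => (hres g u).symm⟩ :
        CoMorphism D₂.Pi (C₂.K)ˣ D₁.Pi (C₂.K)ˣ).H1Map hH ((D₂.unitKummerTheoryTCG C₂).kummer H₂ m₂) =
      (⟨MonoidHom.id D₁.Pi, Φ, fun g u => (hΦs g u).trans (hres g _).symm⟩ :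
        CoMorphism D₁.Pi (C₁.K)ˣ D₁.Pi (C₂.K)ˣ).H1Map (Subgroup.map_id _).le
        ((D₁.unitKummerTheoryTCG C₁).kummer H₁ m₁) := by
  rw [unitKummerTheoryTCG_kummer, unitKummerTheoryTCG_kummer]
  refine CoMorphism.H1Map_kummerClass_eq_of_map_eq _ _ hH _ _ _ ?_
  change tcgToUnit C₂ m₂.1 = Φ (tcgToUnit C₁ m₁.1)
  rw [hΦ, h]

/-- **Same `k̄`, `φ_Π` over `G_k`, `TCG`**: for two models over the same MLF closure, a morphism `φ` of their
`TCG`-pairs with `ε' ∘ φ_Π = ε` whose unit map is the restriction of a Galois-equivariant `Φ : k̄ˣ → k̄ˣ`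
(e.g. `Φ = id` for the inclusion of an open subgroup), the naturality square holds with no auxiliary action.
[cite: MochizukiAbsTopIII2015, Proposition 3.3 (i) p.73] -/
theorem unitKummerTheoryTCG_kummer_natural_of_aug (C : MLFClosure.{0}) (D D' : ModelMLFGaloisData C.k C.K)
    (φ : GaloisMonoidPair.Hom D.tcgPair D'.tcgPair) (haug : ∀ g : D.Pi, D'.aug (φ.homPi g) = D.aug g)
    (Φ : (C.K)ˣ →* (C.K)ˣ) (hΦ : ∀ m : unitSubmonoid C.k C.K, Φ (tcgToUnit C m) = tcgToUnit C (φ.homM m))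
    (hΦs : ∀ (g : D.Pi) (u : (C.K)ˣ), Φ (g • u) = g • Φ u)
    {H₁ : OpenSubgroup D.tcgPair.Pi} {H₂ : OpenSubgroup D'.tcgPair.Pi}
    (hH : (H₁ : Subgroup D.Pi).map φ.homPi ≤ (H₂ : Subgroup D'.Pi))
    (m₁ : {m : D.tcgPair.M // ∀ h : H₁, (h : D.tcgPair.Pi) • m = m})
    (m₂ : {m : D'.tcgPair.M // ∀ h : H₂, (h : D'.tcgPair.Pi) • m = m}) (h : φ.homM m₁.1 = m₂.1) :
    (⟨φ.homPi, MonoidHom.id (C.K)ˣ, fun g u => Units.ext (by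
          change D'.aug (φ.homPi g) • (u : C.K) = D.aug g • (u : C.K)
          rw [haug])⟩ :
        CoMorphism D'.Pi (C.K)ˣ D.Pi (C.K)ˣ).H1Map hH ((D'.unitKummerTheoryTCG C).kummer H₂ m₂) =
      (⟨MonoidHom.id D.Pi, Φ, fun g u => hΦs g u⟩ :
        CoMorphism D.Pi (C.K)ˣ D.Pi (C.K)ˣ).H1Map (Subgroup.map_id _).le
        ((D.unitKummerTheoryTCG C).kummer H₁ m₁) :=
  unitKummerTheoryTCG_kummer_natural C C D D' φ
    (fun g u => Units.ext (by
      change D.aug g • (u : C.K) = D'.aug (φ.homPi g) • (u : C.K)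
      rw [haug])) Φ hΦ
    (fun g u => (hΦs g u).trans (Units.ext (by
      rw [units_coe_smul, units_coe_smul, haug]))) hH m₁ m₂ h

end ModelMLFGaloisData

end Literature.AnabelianGeometry.AbsoluteAnabelian

end
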